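import Mathlib
import Literature.NumberTheory.LFunctions.Zhang2022.Section4Lemma47Rouche
import HarnessLib

/-!
# Zhang (2022), §4 p. 23 / §2 p. 5: Proposition 2.2 (iii) — the gap assertion "`|γ′ − γ − α| < c′α²𝓛`
# for consecutive zeros" — from (4.12) and Proposition 2.2 (i), kernel-checked MODULO the
# exact-count form of Rouché's theorem (FACT F-29, hypothesis form)

Topic `Literature/NumberTheory/LFunctions/Zhang2022` (Landau–Siegel audit tree; verdict-neutral).
Y. Zhang, *Discrete mean estimates and the Landau–Siegel zero*, arXiv:2211.02515v1 (2022)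
[Zhang2022LandauSiegel] — **an unrefereed manuscript under adjudication**; the nodes below are the
campaign's CLAIM nodes (`SkeletonPropositions`, `SkeletonPartOne`, `TypedSection04C`), stated not
asserted. §2 p. 5 (Proposition 2.2 (iii), restated): "if `1/2 + iγ` and `1/2 + iγ′`, `γ′ > γ`, are
consecutive zeros of `L(s,ψ)L(s,ψχ)` in `Ω`, then `|γ′ − γ − α| < c′α²𝓛` for some (large) constant
`c′ > 0`"; §4 p. 23: "It is also proved that the gap between any distinct zeros of `𝒜(s,ψ)` in `Ω` is
`> α(1−c′α𝓛)`. To complete the proof of the gap assertion (iii), it now suffices to prove Lemma 4.7"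
(DAG nodes `Z22:Prop2.2` (iii), `Z22:§4.u058`–`Z22:Lem4.7.pf`; typed deduction `DedProp22iii`).

This file proves

  `prop22iii_of_rouche : RouchéCount → Lemma42 → Eq412 → Prop22i → ∃ c₀, ∀ c′ ≥ c₀, Prop22iii c′`

with **`RouchéCount` = FACT F-29 of the frozen FACT-LIST in HYPOTHESIS FORM** (Conway V §3 Thm 3.8;
binder identical to `Section4Lemma46Rouche`). It does NOT go through the typed deduction
`DedProp22iii` (Lemma 4.7 as "three DISTINCT zeros in `|w| < α(1+c′α𝓛)`" + the gap remark): that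
route is blind at the bottom edge of the height window of `Ω`, where the lower outer zero may leave
`Ω` and nothing typed then forces a zero ABOVE `ρ` within `α(1+c′α𝓛)`. Instead it uses the LOCATED
zeros of `Section4Lemma47Rouche.three_zeros_of_rouche` — for a zero `s ∈ Ω` of `L(s,ψ)L(s,ψχ)` (on
the line by Prop. 2.2 (i)) the zeros of `𝒜(s+w,ψ)` in `|w| < α(1+c′α𝓛)` are `0`, `iα + v₁`,
`−iα + v₋₁` with `|v_{±1}| < c′α²𝓛`: the point `a = s + iα + v₁` is a zero of `L·L` (`F(a) ≠ 0`,
Lemma 4.2), it lies strictly above `s`, and either `a ∈ Ω` (then the next zero `s′` is not above `a`,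
by consecutiveness) or `a` is above the window (then again `γ′ ≤ Im a`); so `γ′ − γ − α ≤ Im v₁ <
c′α²𝓛`, and `s′ − s`, a non-zero zero of `𝒜(s+·)` of modulus `γ′ − γ < α + c′α²𝓛`, must be
`iα + v₁` itself, whence `γ′ − γ − α = Im v₁ > −c′α²𝓛`.

The Rouché binder is discharged in `Section4RoucheDischarged` (FACT F-29 is now the tree theorem
`Literature.Analysis.Complex.Rouche.finsum_analyticOrderNatAt_eq_of_norm_sub_lt`, whose type is the
binder verbatim).

What is NOT asserted: Rouché's theorem; Lemma 4.2; (4.12); Proposition 2.2 (i) (CLAIM nodes);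
hence not Proposition 2.2 (iii) as such. Nothing about Theorems 1–2 of the source is stated or implied;
nothing here bears on the cell's verdict on (8.24).

## References

* Y. Zhang, arXiv:2211.02515v1 (2022), §2 p. 5 (Prop. 2.2 (iii) restated), §4 p. 23 (Lemma 4.7
  and the gap remark). [cite: Zhang2022LandauSiegel, §2 Prop. 2.2 (iii); §4 p. 23]
* J. B. Conway, *Functions of One Complex Variable* (1973), V §3 Thm 3.8 (Rouché) = FACT F-29.
-/

noncomputable section

open Complex Real Set Filter Topology

namespace Literature.NumberTheory.LFunctions.Zhang2022.Section4

open Literature.NumberTheory.LFunctions.Zhang2022.Skeleton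

variable {D : ℕ} [NeZero D] (χ : DirichletCharacter ℂ D)

omit [NeZero D] in
/-- `α ≤ 1/1000` once `𝓛 ≥ 3` (`α = π𝓛⁻⁹ ≤ π/3⁹`). [cite: Zhang2022LandauSiegel, §2 (2.10)] -/
theorem alpha_le_of_three_le_ell (hℓ : 3 ≤ ell D) : alpha D ≤ 1 / 1000 := by
  have hℓ0 : 0 < ell D := by linarith
  rw [Section2.alpha_eq_pi_div_ell9, div_le_div_iff₀ (pow_pos hℓ0 9) (by norm_num)]
  have h9 : (3 : ℝ) ^ 9 ≤ ell D ^ 9 := by gcongr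
  nlinarith [Real.pi_lt_four]

/-- A zero of `L(s,ψ)L(s,ψχ)` is a zero of `𝒜 = L·L/F` (whatever `F` is: `0/F = 0`).
[cite: Zhang2022LandauSiegel, §4 p. 21] -/
theorem calA_eq_zero_of_mem_prodZeroSetOmega (x : Chr D) {s : ℂ} (hs : s ∈ prodZeroSetOmega χ x) :
    calA χ x s = 0 := by
  have h : LL χ x s = 0 := hs.2
  rw [calA, h, zero_div]

/-- **Proposition 2.2 (iii) modulo Rouché** (`Z22:Prop2.2` (iii), §2 p. 5; §4 p. 23): given the
exact-count Rouché theorem `hRouche` **-- FACT F-29 (hypothesis form)** [Conway 1973, V §3 Thm 3.8],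
Lemma 4.2, (4.12) and Proposition 2.2 (i), there is `c₀` such that for every `c′ ≥ c₀`, `D` large and
`ψ ∈ Ψ₁`: consecutive zeros `s = 1/2 + iγ`, `s′ = 1/2 + iγ′` (`γ < γ′`, no zero of `L(s,ψ)L(s,ψχ)` in
`Ω` strictly between) satisfy `|γ′ − γ − α| < c′α²𝓛` — the node `Skeleton.Prop22iii c′`. Via the
located zeros `0, iα + v₁, −iα + v₋₁` (`|v_{±1}| < c′α²𝓛`) of `𝒜(s+·,ψ)` in `|w| < α(1+c′α𝓛)`
(`three_zeros_of_rouche`): `a = s + iα + v₁` is a zero of `L·L` above `s` and not strictly between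
`s` and `s′`, so `γ′ − γ − α ≤ Im v₁`; and `s′ − s ∈ {iα + v₁, −iα + v₋₁}` forces `s′ − s = iα + v₁`.
[cite: Zhang2022LandauSiegel, §2 Prop. 2.2 (iii)] -/
theorem prop22iii_of_rouche
    -- FACT F-29 (hypothesis form): Rouché's theorem, exact-count form [Conway 1973, V.3.8]
    (hRouche : ∀ (f g : ℂ → ℂ) (c : ℂ) (r : ℝ), 0 < r →
      (∃ U : Set ℂ, IsOpen U ∧ Metric.closedBall c r ⊆ U ∧ DifferentiableOn ℂ f U ∧
        DifferentiableOn ℂ g U) →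
      (∀ z ∈ Metric.sphere c r, ‖f z - g z‖ < ‖g z‖) →
      ∑ᶠ z ∈ Metric.ball c r, analyticOrderNatAt f z =
        ∑ᶠ z ∈ Metric.ball c r, analyticOrderNatAt g z)
    (h42 : Lemma42) (h412 : Eq412) (hi : Prop22i) :
    ∃ c₀ : ℝ, ∀ c' : ℝ, c₀ ≤ c' → Prop22iii c' := by
  obtain ⟨c₀, h3⟩ := three_zeros_of_rouche hRouche h42 h412
  obtain ⟨C₂, h42'⟩ := h42
  refine ⟨c₀, fun c' hc' => ?_⟩
  obtain ⟨D₁, hD₁, hδD⟩ := exists_delta_le c' (1 / 200) (by norm_num)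
  obtain ⟨D₀, hD₀⟩ := ((h3 c' hc').and hi).and h42'
  refine ⟨max (max D₀ D₁) (max 3 ⌈Real.exp (max 3 (2 * C₂))⌉₊),
    fun D _ χ hD hq hp x hx s hs s' hs' hlt hcons => ?_⟩
  -- thresholds
  have hDD₀ : D₀ ≤ D := le_trans (le_trans (le_max_left _ _) (le_max_left _ _)) hD
  have hDD₁ : D₁ ≤ D := le_trans (le_trans (le_max_right _ _) (le_max_left _ _)) hD
  have hD3 : 3 ≤ D := le_trans (le_trans (le_max_left _ _) (le_max_right _ _)) hD
  have hDe : ⌈Real.exp (max 3 (2 * C₂))⌉₊ ≤ D :=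
    le_trans (le_trans (le_max_right _ _) (le_max_right _ _)) hD
  obtain ⟨hℓ3, hℓC⟩ := max_le_iff.mp (le_ell_of_ceil_exp_le hDe)
  have hℓ0 : 0 < ell D := by linarith
  have hℓ1 : 1 ≤ ell D := by linarith
  obtain ⟨⟨e3, ei⟩, e42⟩ := hD₀ D χ hDD₀ hq hp
  -- parameters: `α`, the bound `b = c′α²𝓛 = (c′α𝓛)·α ≤ α/200`
  have hα : 0 < alpha D := by
    rw [Section2.alpha_eq_pi_div_ell9]; exact div_pos Real.pi_pos (pow_pos hℓ0 9)
  have hαsmall : alpha D ≤ 1 / 1000 := alpha_le_of_three_le_ell hℓ3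
  set b : ℝ := c' * alpha D ^ 2 * ell D with hb
  have hδ : c' * alpha D * ell D ≤ 1 / 200 := hδD D hDD₁
  have hbα : b ≤ alpha D / 200 := by
    have : b = (c' * alpha D * ell D) * alpha D := by rw [hb]; ring
    rw [this]; nlinarith
  have hRb : alpha D * (1 + c' * alpha D * ell D) = alpha D + b := by rw [hb]; ring
  -- the two consecutive zeros: on the line, in the window, zeros of `𝒜`
  have hre : s.re = 1 / 2 := ei x hx s hs
  have hre' : s'.re = 1 / 2 := ei x hx s' hs'
  have hAs : calA χ x s = 0 := calA_eq_zero_of_mem_prodZeroSetOmega χ x hs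
  have hAs' : calA χ x s' = 0 := calA_eq_zero_of_mem_prodZeroSetOmega χ x hs'
  have hγ : |s.im - 2 * π * t0 D| < ell1 D + 2 := by
    have h := hs.1.2; rwa [Complex.sub_im, s0_im] at h
  have hγ' : |s'.im - 2 * π * t0 D| < ell1 D + 2 := by
    have h := hs'.1.2; rwa [Complex.sub_im, s0_im] at h
  obtain ⟨hγl, hγu⟩ := abs_lt.mp hγ
  obtain ⟨hγl', hγu'⟩ := abs_lt.mp hγ'
  -- the located zeros of `𝒜(s + ·)`
  obtain ⟨v₁, vm, hv₁, hvm, hset⟩ := e3 x hx s hAs hre hγ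
  have hv₁im : |v₁.im| < b := lt_of_le_of_lt (Complex.abs_im_le_norm v₁) hv₁
  have hv₁re : |v₁.re| < b := lt_of_le_of_lt (Complex.abs_re_le_norm v₁) hv₁
  have hvmim : |vm.im| < b := lt_of_le_of_lt (Complex.abs_im_le_norm vm) hvm
  obtain ⟨hv₁im1, hv₁im2⟩ := abs_lt.mp hv₁im
  obtain ⟨hv₁re1, hv₁re2⟩ := abs_lt.mp hv₁re
  obtain ⟨-, hvmim2⟩ := abs_lt.mp hvmim
  -- the zero `a = s + iα + v₁` above `s`
  set w₁ : ℂ := I * (alpha D : ℂ) + v₁ with hw₁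
  have hw₁mem : w₁ ∈ ({(0 : ℂ), I * (alpha D : ℂ) + v₁, -(I * (alpha D : ℂ)) + vm} : Set ℂ) := by
    simp [hw₁]
  rw [← hset] at hw₁mem
  obtain ⟨hw₁R, hAa⟩ := hw₁mem
  have hw₁im : w₁.im = alpha D + v₁.im := by simp [hw₁]
  have hw₁re : w₁.re = v₁.re := by simp [hw₁]
  have haim : (s + w₁).im = s.im + alpha D + v₁.im := by rw [Complex.add_im, hw₁im]; ring
  have hare : (s + w₁).re = 1 / 2 + v₁.re := by rw [Complex.add_re, hw₁re, hre]
  -- `F(a) ≠ 0` (Lemma 4.2: `a ∈ Ω₁`), so `a` is a zero of `L·L`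
  have hρeq : (1 / 2 : ℂ) + (s.im : ℂ) * I = s := by
    apply Complex.ext <;> simp [hre]
  have hw₁2α : ‖w₁‖ < 2 * alpha D := by
    have : alpha D * (1 + c' * alpha D * ell D) < 2 * alpha D := by rw [hRb]; linarith
    exact hw₁R.trans this
  have hΩ1 : s + w₁ ∈ Omega1 D := by
    have h := half_add_mem_Omega1 hℓ3 hγ hw₁2α
    rwa [hρeq] at h
  have hhalf : C₂ * (ell D ^ 227)⁻¹ ≤ 1 / 2 := by
    have h227 : ell D ≤ ell D ^ 227 := by
      calc ell D = ell D ^ 1 := (pow_one _).symm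
        _ ≤ ell D ^ 227 := pow_le_pow_right₀ hℓ1 (by norm_num)
    rw [← div_eq_mul_inv, div_le_iff₀ (pow_pos hℓ0 _)]
    linarith
  have hFa : Fpoly χ x (s + w₁) ≠ 0 :=
    (inv_norm_le_two_mul_of_norm_mul_sub_one_le ((e42 x hx _ hΩ1).trans hhalf)).1
  have hLLa : LL χ x (s + w₁) = 0 := by
    have h := hAa
    rw [calA, div_eq_zero_iff] at h
    exact h.resolve_right hFa
  -- `γ′ ≤ Im a`: otherwise `a` would be a zero of `L·L` in `Ω` strictly between `s` and `s′`
  have hle : s'.im ≤ (s + w₁).im := by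
    by_contra hlt'
    push Not at hlt'
    have hgt : s.im < (s + w₁).im := by rw [haim]; linarith
    have haΩ : s + w₁ ∈ Omega D := by
      refine ⟨?_, ?_⟩
      · rw [Complex.sub_re, s0_re, hare]
        rw [abs_lt]; constructor <;> linarith
      · rw [Complex.sub_im, s0_im]
        rw [abs_lt]; constructor <;> linarith
    exact hcons (s + w₁) ⟨haΩ, hLLa⟩ ⟨hgt, hlt'⟩
  have hupper : s'.im - s.im - alpha D < b := by rw [haim] at hle; linarith
  -- `s′ − s` is a non-zero zero of `𝒜(s + ·)` in the big disc, hence `= iα + v₁`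
  have hlower : -b < s'.im - s.im - alpha D := by
    set w' : ℂ := s' - s with hw'
    have hw'eq : w' = ((s'.im - s.im : ℝ) : ℂ) * I := by
      apply Complex.ext <;> simp [hw', hre, hre']
    have hw'norm : ‖w'‖ = s'.im - s.im := by
      rw [hw'eq, norm_mul, Complex.norm_real, Complex.norm_I, mul_one,
        Real.norm_of_nonneg (by linarith)]
    have hw'im : w'.im = s'.im - s.im := by simp [hw']
    have hw'R : ‖w'‖ < alpha D * (1 + c' * alpha D * ell D) := by
      rw [hRb, hw'norm]; linarith
    have hw'z : calA χ x (s + w') = 0 := by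
      have : s + w' = s' := by rw [hw']; ring
      rw [this]; exact hAs'
    have hw'mem : w' ∈ {w : ℂ | ‖w‖ < alpha D * (1 + c' * alpha D * ell D) ∧ calA χ x (s + w) = 0} :=
      ⟨hw'R, hw'z⟩
    rw [hset] at hw'mem
    simp only [Set.mem_insert_iff, Set.mem_singleton_iff] at hw'mem
    rcases hw'mem with h0 | h1 | hm
    · -- `w′ = 0` contradicts `γ < γ′`
      have : w'.im = 0 := by rw [h0]; simp
      rw [hw'im] at this; linarith
    · -- `w′ = iα + v₁`
      have : w'.im = alpha D + v₁.im := by rw [h1, hw₁im]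
      rw [hw'im] at this; linarith
    · -- `w′ = −iα + v₋₁` has negative imaginary part
      have : w'.im = -alpha D + vm.im := by rw [hm]; simp
      rw [hw'im] at this
      have : b < alpha D := by linarith
      linarith
  exact abs_lt.mpr ⟨hlower, hupper⟩

end Literature.NumberTheory.LFunctions.Zhang2022.Section4
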